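import Summits.PneNP.PneNP.Theorems.SupportRectangleBlockLiftCells
import Summits.PneNP.PneNP.Theorems.SmallBlockRothvossBallGridBound
import HarnessLib

/-!
# Block psd factorizations from SUPPORT-rectangle bounds: the abstract core (cell pnp-psdrank, eng g5)

File 2 of the support-rectangle block chain. The classical rectangle-COVERING currency (fooling sets,
Razborov / Kaibel–Weltge-type bounds "every rectangle inside `supp S` has `W`-mass `≤ θ₀`") lifts to
block-psd factorizations with the exponent divided by `b + 1`:

* `core_supp` — ABSTRACT CORE: finite index types, `0 ≤ S ≤ Δ`, weights `W ≤ K`, `K ≥ 0`, `ΣK ≤ 1`,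
  `⟨W, S⟩ = 1`, and `Σ_{X×Y} W ≤ θ₀` for every rectangle `X × Y ⊆ supp S`: every `m`-term `(S^b_+)`
  factorization of `S` obeys `1/2 ≤ b⁴ Δ m ((2L+1)^{2b} θ₀ + 448 b Δ²/L²)` at every grid resolution `L`
  (the square-root pieces of a block pairing vanish wherever `S` does, so the support-form net
  `netBall_supp` applies);
* `blockBound_supp` — the resulting bound **`(2/θ₀)^{1/(b+1)} ≤ m · 14400 b⁵ Δ³`** (`b ≥ 1`, `Δ ≥ 2`),
  the psd-block analogue of the tree's support-form hyperplane bound for nonnegative rank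
  (`Literature.Barriers.PneNP.hyperplane_separation_bound'`, [cite: Rothvoss2017, Lemma 5]) obtained with
  the weak Briët–Dadush–Pokutta rescaling [cite: BrietDadushPokutta2014, Thm. 6].

Consumer: `SupportRectangleBlockLiftUDISJ` — with Kaibel–Weltge's `(2/3)^n` bound for the unique-disjointness
support, `(3/2)^{n/(b+1)} ≤ m · 14400 b⁵ n⁶` for `(S^b_+)^m` factorizations of `UDISJ(n)`, hence for
block-diagonal SDP lifts of the correlation / cut polytopes — exponentially stronger in `b` than
Fawzi–Parrilo's `((1 − 3^{−b})^{−1/b})^n` [cite: FawziParrilo2013, Thm. 1].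
WHAT THIS IS NOT: nothing here bounds general psd rank (one block of dimension `≳ log(1/θ₀)/log Δ` escapes);
for the matching polytope the support currency is void (its support has polynomial rectangle covers —
Yannakakis), which is why the matching files use Rothvoß's all-rectangle datum; nothing is P ≠ NP-relevant.
-/

set_option linter.dupNamespace false -- `Summit.PneNP.PneNP.…`: summit = sub-problem (D-0017)

noncomputable section

open scoped Classical MatrixOrder

open Finset Real Matrix Literature.Combinatorics.Optimization
  Literature.Combinatorics.Optimization.EquivariantPsdStructure
  Summit.PneNP.PneNP.Theorems.SmallBlockRothvossBallGrid

namespace Summit.PneNP.PneNP.Theorems.SupportRectangleBlockLift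

/-! ### The abstract core: block psd factorizations of a matrix with a support-rectangle datum -/

/-- **Abstract core (support form).** Finite index types; a matrix `S ≤ Δ` (`Δ ≥ 1`) written as a sum of
`m` pairings of psd `b × b` blocks (`b ≥ 1`); a weight datum `W ≤ K`, `K ≥ 0`, `ΣK ≤ 1`, `⟨W, S⟩ = 1` whose
rectangle sums are `≤ θ₀` on every rectangle INSIDE THE SUPPORT of `S`. Then for every grid resolution
`L ≥ 1` with `b ≤ L²`: `1/2 ≤ b⁴ Δ m ((2L+1)^{2b} θ₀ + 448 b Δ²/L²)`. Ingredients: the weak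
Briët–Dadush–Pokutta rescaling blockwise (`HasPsdFactorization.rescale_weak`), the square-root split
(`trace_mul_eq_sum_sq_sqrtRow`) — whose pieces vanish wherever `S` does, since `S ≥` each block pairing `≥`
each squared piece — the support-form net `netBall_supp`, and `SmallBlockRothvoss.abstract_accounting`. -/
theorem core_supp {α β : Type} [Fintype α] [Fintype β] (S W K : α → β → ℝ) {Δ θ₀ : ℝ}
    (hΔ1 : 1 ≤ Δ) (hθ : 0 ≤ θ₀) (hSΔ : ∀ x y, S x y ≤ Δ)
    (hK0 : ∀ x y, 0 ≤ K x y) (hWK : ∀ x y, W x y ≤ K x y) (hKsum : ∑ x, ∑ y, K x y ≤ 1)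
    (hWS : ∑ x, ∑ y, W x y * S x y = 1)
    (hsupp : ∀ (X : Finset α) (Y : Finset β), (∀ x ∈ X, ∀ y ∈ Y, S x y ≠ 0) →
      ∑ x ∈ X, ∑ y ∈ Y, W x y ≤ θ₀)
    {b m : ℕ} (hb : 1 ≤ b) (A : α → Fin m → Matrix (Fin b) (Fin b) ℝ)
    (B : β → Fin m → Matrix (Fin b) (Fin b) ℝ)
    (hA : ∀ x i, (A x i).PosSemidef) (hB : ∀ y i, (B y i).PosSemidef)
    (hfac : ∀ x y, S x y = ∑ i, (A x i * B y i).trace)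
    (L : ℕ) (hL : 0 < L) (hbL : b ≤ L ^ 2) :
    (1 : ℝ) / 2 ≤ (b : ℝ) ^ 4 * Δ * m *
      (((2 * L + 1 : ℝ) ^ b) ^ 2 * θ₀ + 448 * b * Δ ^ 2 / (L : ℝ) ^ 2) := by
  have hΔ0 : 0 < Δ := by linarith
  have hL' : (0 : ℝ) < L := by exact_mod_cast hL
  have hb0 : (0 : ℝ) < b := by exact_mod_cast hb
  set η : ℝ := 1 / (2 * Δ) with hηdef
  have hη : 0 < η := by rw [hηdef]; positivity
  have hη1 : η ≤ 1 := by
    rw [hηdef, div_le_one (by positivity)]; linarith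
  have hηΔ : η * Δ = 1 / 2 := by rw [hηdef]; field_simp
  set τ : ℝ := 112 * b / (η ^ 2 * (L : ℝ) ^ 2) with hτdef
  have hτ0 : 0 ≤ τ := by rw [hτdef]; positivity
  have hτeq : τ = 448 * b * Δ ^ 2 / (L : ℝ) ^ 2 := by
    rw [hτdef, hηdef]; field_simp; ring
  -- blocks
  set T : Fin m → α → β → ℝ := fun i x y => (A x i * B y i).trace with hTdef
  have hST : ∀ x y, S x y = ∑ i, T i x y := fun x y => hfac x y
  have hTfac : ∀ i, HasPsdFactorization (T i) b := fun i =>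
    ⟨fun x => A x i, fun y => B y i, fun x => hA x i, fun y => hB y i, fun x y => rfl⟩
  have hT0 : ∀ i x y, 0 ≤ T i x y := fun i x y => (hTfac i).entry_nonneg x y
  have hTΔ : ∀ i x y, T i x y ≤ Δ := by
    intro i x y
    have h1 : T i x y ≤ ∑ j, T j x y :=
      single_le_sum (f := fun j => T j x y) (fun j _ => hT0 j x y) (mem_univ i)
    linarith [hST x y, hSΔ x y]
  have hresc : ∀ i, ∃ (X : α → Matrix (Fin b) (Fin b) ℝ) (Y : β → Matrix (Fin b) (Fin b) ℝ),
      (∀ x, (X x).PosSemidef ∧ (1 - X x).PosSemidef) ∧ (∀ y, (Y y).PosSemidef ∧ (1 - Y y).PosSemidef) ∧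
      ∀ x y, T i x y = ((b : ℕ) : ℝ) ^ 2 * Δ * (X x * Y y).trace :=
    fun i => (hTfac i).rescale_weak hΔ0 (hTΔ i)
  choose X Y hX hY hTXY using hresc
  -- the rank-one-vector pieces
  set G : (Fin m × (Fin b × Fin b)) → α → β → ℝ :=
    fun ipq x y => (sqrtRow (X ipq.1 x) ipq.2.1 ⬝ᵥ sqrtRow (Y ipq.1 y) ipq.2.2) ^ 2 with hGdef
  have hG0 : ∀ ipq x y, 0 ≤ G ipq x y := fun ipq x y => sq_nonneg _
  have hTG : ∀ i x y, T i x y = ((b : ℝ) ^ 2 * Δ) * ∑ pq : Fin b × Fin b, G (i, pq) x y := by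
    intro i x y
    rw [hTXY i x y, trace_mul_eq_sum_sq_sqrtRow (hX i x).1 (hY i y).1,
      Fintype.sum_prod_type (f := fun pq : Fin b × Fin b => G (i, pq) x y)]
  have hS : ∀ x y, S x y = ((b : ℝ) ^ 2 * Δ) * ∑ ipq, G ipq x y := by
    intro x y
    rw [hST x y, Fintype.sum_prod_type (f := fun ipq : Fin m × (Fin b × Fin b) => G ipq x y), mul_sum]
    exact sum_congr rfl fun i _ => hTG i x y
  -- support: every piece vanishes wherever `S` does
  have hc0 : (0 : ℝ) < (b : ℝ) ^ 2 * Δ := mul_pos (pow_pos hb0 2) hΔ0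
  have hpiece0 : ∀ (ipq : Fin m × (Fin b × Fin b)) (x : α) (y : β), S x y = 0 →
      sqrtRow (X ipq.1 x) ipq.2.1 ⬝ᵥ sqrtRow (Y ipq.1 y) ipq.2.2 = 0 := by
    intro ipq x y hS0
    have h1 : ∑ jpq, G jpq x y = 0 := by
      have h2 := hS x y
      rw [hS0] at h2
      rcases mul_eq_zero.1 h2.symm with h3 | h3
      · exact absurd h3 hc0.ne'
      · exact h3
    have h4 : G ipq x y = 0 := (sum_eq_zero_iff_of_nonneg fun jpq _ => hG0 jpq x y).1 h1 ipq (mem_univ _)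
    exact pow_eq_zero_iff (two_ne_zero) |>.1 h4
  -- per-piece net (support form)
  set E : ℝ := ((2 * L + 1 : ℝ) ^ b) ^ 2 * θ₀ with hEdef
  have hpiece : ∀ ipq, ∑ x, ∑ y, W x y * G ipq x y ≤
      E + η * ∑ x, ∑ y, K x y * G ipq x y + τ * ∑ x, ∑ y, K x y := by
    intro ipq
    refine netBall_supp W K θ₀ η τ L (fun x => sqrtRow (X ipq.1 x) ipq.2.1)
      (fun y => sqrtRow (Y ipq.1 y) ipq.2.2) hK0 hWK hθ hη hη1 hL hbL
      (fun x => sqrtRow_sq_le_one (hX ipq.1 x).1 (hX ipq.1 x).2 _)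
      (fun y => sqrtRow_sq_le_one (hY ipq.1 y).1 (hY ipq.1 y).2 _) ?_ le_rfl
    intro X' Y' hnz
    exact hsupp X' Y' fun x hx y hy hS0 => hnz x hx y hy (hpiece0 ipq x y hS0)
  -- `⟨K, S⟩ ≤ Δ`
  have hKS : ∑ x, ∑ y, K x y * S x y ≤ Δ := by
    calc ∑ x, ∑ y, K x y * S x y ≤ ∑ x, ∑ y, K x y * Δ :=
          sum_le_sum fun x _ => sum_le_sum fun y _ => mul_le_mul_of_nonneg_left (hSΔ x y) (hK0 x y)
      _ = (∑ x, ∑ y, K x y) * Δ := by rw [sum_mul]; simp_rw [sum_mul]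
      _ ≤ 1 * Δ := mul_le_mul_of_nonneg_right hKsum hΔ0.le
      _ = Δ := one_mul Δ
  have key := SmallBlockRothvoss.abstract_accounting W K S G ((b : ℝ) ^ 2 * Δ) E η τ Δ
    hc0.le hη.le hWS hS hpiece hKS
  -- arithmetic
  have hcard : (Fintype.card (Fin m × (Fin b × Fin b)) : ℝ) = m * (b : ℝ) ^ 2 := by
    simp only [Fintype.card_prod, Fintype.card_fin]; push_cast; ring
  rw [hcard, hηΔ] at key
  have hKτ : τ * ∑ x, ∑ y, K x y ≤ τ := by
    calc τ * ∑ x, ∑ y, K x y ≤ τ * 1 := mul_le_mul_of_nonneg_left hKsum hτ0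
      _ = τ := mul_one τ
  have hm0 : (0 : ℝ) ≤ m := Nat.cast_nonneg m
  have hpre : (0 : ℝ) ≤ (b : ℝ) ^ 2 * Δ * (m * (b : ℝ) ^ 2) :=
    mul_nonneg hc0.le (mul_nonneg hm0 (sq_nonneg _))
  have h1 : (b : ℝ) ^ 2 * Δ * (m * (b : ℝ) ^ 2 * (E + τ * ∑ x, ∑ y, K x y)) ≤
      (b : ℝ) ^ 2 * Δ * (m * (b : ℝ) ^ 2) * (E + τ) := by
    have := mul_le_mul_of_nonneg_left (show E + τ * ∑ x, ∑ y, K x y ≤ E + τ by linarith) hpre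
    linarith [this]
  have hmain : (1 : ℝ) / 2 ≤ (b : ℝ) ^ 2 * Δ * (m * (b : ℝ) ^ 2) * (E + τ) := by linarith
  rw [hEdef, hτeq] at hmain
  have hfin : (b : ℝ) ^ 2 * Δ * (m * (b : ℝ) ^ 2) *
      (((2 * L + 1 : ℝ) ^ b) ^ 2 * θ₀ + 448 * b * Δ ^ 2 / (L : ℝ) ^ 2) =
      (b : ℝ) ^ 4 * Δ * m * (((2 * L + 1 : ℝ) ^ b) ^ 2 * θ₀ + 448 * b * Δ ^ 2 / (L : ℝ) ^ 2) := by
    ring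
  linarith [hfin]

/-- **Block psd factorizations from a support-rectangle datum.** Finite index types; `S ≤ Δ` (`Δ ≥ 2`) a
sum of `m` pairings of psd `b × b` blocks (`b ≥ 1`); a weight datum `W ≤ K`, `K ≥ 0`, `ΣK ≤ 1`,
`⟨W, S⟩ = 1` with `Σ_{X×Y} W ≤ θ₀` (`θ₀ > 0`) on every rectangle `X × Y` inside the support of `S`. Then
**`(2/θ₀)^{1/(b+1)} ≤ m · 14400 b⁵ Δ³`**, i.e. `m ≥ (2/θ₀)^{1/(b+1)}/(14400 b⁵ Δ³)`: a rectangle-covering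
bound `1/θ₀` for the nonnegative rank lifts to `(S^b_+)^m` factorizations with the exponent divided by
`b + 1`. (Proof: `core_supp` at the grid resolution `L` with `2L+1` the least odd integer
`≥ λ = (2/θ₀)^{1/(2b+2)}` when `λ ≥ 4b` — `SmallBlockRothvossBallGrid.caseA_arith` — and the trivial bound
`m ≥ 1` otherwise.) The `b = 1` case is a (weak) form of the classical rectangle bound; for the
unique-disjointness matrix see `SupportRectangleBlockLiftUDISJ`. -/
theorem blockBound_supp {α β : Type} [Fintype α] [Fintype β] (S W K : α → β → ℝ) {Δ θ₀ : ℝ}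
    (hΔ2 : 2 ≤ Δ) (hθ0 : 0 < θ₀) (hSΔ : ∀ x y, S x y ≤ Δ)
    (hK0 : ∀ x y, 0 ≤ K x y) (hWK : ∀ x y, W x y ≤ K x y) (hKsum : ∑ x, ∑ y, K x y ≤ 1)
    (hWS : ∑ x, ∑ y, W x y * S x y = 1)
    (hsupp : ∀ (X : Finset α) (Y : Finset β), (∀ x ∈ X, ∀ y ∈ Y, S x y ≠ 0) →
      ∑ x ∈ X, ∑ y ∈ Y, W x y ≤ θ₀)
    {b m : ℕ} (hb : 1 ≤ b) (A : α → Fin m → Matrix (Fin b) (Fin b) ℝ)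
    (B : β → Fin m → Matrix (Fin b) (Fin b) ℝ)
    (hA : ∀ x i, (A x i).PosSemidef) (hB : ∀ y i, (B y i).PosSemidef)
    (hfac : ∀ x y, S x y = ∑ i, (A x i * B y i).trace) :
    (2 / θ₀) ^ ((1 : ℝ) / (b + 1)) ≤ m * (14400 * (b : ℝ) ^ 5 * Δ ^ 3) := by
  have hΔ1 : (1 : ℝ) ≤ Δ := by linarith
  have hb1 : (1 : ℝ) ≤ b := by exact_mod_cast hb
  have hm0 : (0 : ℝ) ≤ m := Nat.cast_nonneg m
  -- `θ = θ₀ / 2`, `λ = (1/θ)^{1/(2(b+1))}`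
  set θ : ℝ := θ₀ / 2 with hθdef
  have hθpos : 0 < θ := by rw [hθdef]; positivity
  have hθ₀ : θ₀ = 2 * θ := by rw [hθdef]; ring
  have hinv : 2 / θ₀ = 1 / θ := by rw [hθ₀]; field_simp
  set lam : ℝ := (1 / θ) ^ ((1 : ℝ) / (2 * (b + 1))) with hlam
  have h1θ : 0 < 1 / θ := by positivity
  have hlam0 : 0 < lam := Real.rpow_pos_of_pos h1θ _
  have hlamsq : lam ^ 2 = (2 / θ₀) ^ ((1 : ℝ) / (b + 1)) := by
    rw [hinv, hlam, ← Real.rpow_natCast, ← Real.rpow_mul h1θ.le]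
    congr 1
    push_cast
    field_simp
  have hθlam : θ * lam ^ (2 * b + 2) = 1 := by
    rw [hlam, ← Real.rpow_natCast, ← Real.rpow_mul h1θ.le]
    have : (1 : ℝ) / (2 * (b + 1)) * ((2 * b + 2 : ℕ) : ℝ) = 1 := by
      push_cast
      field_simp
    rw [this, Real.rpow_one]
    field_simp
  rw [← hlamsq]
  -- the core inequality, with `θ₀ = 2θ`
  have hcore : ∀ L : ℕ, 0 < L → b ≤ L ^ 2 →
      (1 : ℝ) / 2 ≤ (b : ℝ) ^ 4 * Δ * m *
        (((2 * L + 1 : ℝ) ^ b) ^ 2 * (2 * θ) + 448 * b * Δ ^ 2 / (L : ℝ) ^ 2) := by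
    intro L hL hbL
    have := core_supp S W K hΔ1 hθ0.le hSΔ hK0 hWK hKsum hWS hsupp hb A B hA hB hfac L hL hbL
    rwa [hθ₀] at this
  -- `m ≥ 1`, read off the grid at resolution `L = b`
  have key0 := hcore b hb (Nat.le_self_pow two_ne_zero b)
  have hm1 : (1 : ℝ) ≤ m := by
    rcases Nat.eq_zero_or_pos m with hm | hm
    · exfalso
      rw [hm] at key0
      norm_num at key0
    · exact_mod_cast hm
  by_cases hcase : 4 * (b : ℝ) ≤ lam
  · -- Case A: the grid at resolution `L`, `2L + 1` the least odd integer `≥ λ`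
    have hLge : (lam - 1) / 2 ≤ (⌈(lam - 1) / 2⌉₊ : ℝ) := Nat.le_ceil _
    have hLlt : (⌈(lam - 1) / 2⌉₊ : ℝ) < (lam - 1) / 2 + 1 := Nat.ceil_lt_add_one (by linarith)
    have hLb : (b : ℝ) ≤ (⌈(lam - 1) / 2⌉₊ : ℝ) := by linarith
    have hLb' : b ≤ ⌈(lam - 1) / 2⌉₊ := by exact_mod_cast hLb
    have hLpos : 0 < ⌈(lam - 1) / 2⌉₊ := lt_of_lt_of_le hb hLb'
    have key := hcore ⌈(lam - 1) / 2⌉₊ hLpos (hLb'.trans (Nat.le_self_pow two_ne_zero _))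
    exact caseA_arith b hb1 hΔ2 hm0 hlam0 hcase hLge hLlt hθpos hθlam key
  · -- Case B: `λ < 4b`
    push Not at hcase
    exact caseB_arith b hb hΔ2 hm1 hlam0 hcase

/-! ### Note on the matching chain's datum (precision of the header, appended by eng g5 the same day)

The header's phrase «the matching files use Rothvoß's all-rectangle datum» should be read precisely: the tree's Rothvoß
Lemma 7 (`Literature.Barriers.PneNP.lemma7_of_bad_fibre_bound`) is itself a SUPPORT-rectangle statement (hypothesis
`havoid : ∀ U ∈ X, ∀ M ∈ Y, |δ(U) ∩ M| ≠ 1`), and the weight `Literature.Barriers.PneNP.Wmat` carries a `−1` penalty on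
every tight pair precisely so that this support bound READS as the all-rectangle bound packaged in `exists_WK_fin` and
consumed by `SmallBlockRothvossBallGrid.core_at`. So `blockBound_supp` is the general form of the input used by the
whole block family; what is void for the matching polytope are NONNEGATIVE support data (`W = K ≥ 0`, the
covering/fooling currency — Yannakakis' polynomial rectangle covers of `supp S_PM`), not support data as such: Rothvoß's
SIGNED two-level weight is a support datum. A consequence worth recording: no `ε`-shifted (approximation-robust) version
follows from these inputs, since `⟨Wmat, S + ε⟩ < 0` for every `ε > 0`. -/

end Summit.PneNP.PneNP.Theorems.SupportRectangleBlockLift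

end
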